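import Summits.Ventures.Crystal3D.Theorems.StickyWulffConstantTextureBuildRiserEnter
import Summits.Ventures.Crystal3D.Theorems.StickyWulffConstantTextureLiminfRungPerBox
import Literature.Algebra.EuclideanLattices.FccBccLattices
import HarnessLib

/-!
# The RISER PACKAGE (B6), part 11: the AREA OF A WALL RECTANGLE
# (lane T, crux `TextureLiminfV5`, stmt-Ventures-23912; design memo HOME/wulff-p2/g21/B6-DESIGN-g21.md §3 (curtains); target `RiserPackage₇` of '…TextureBuildMeshV7')

HONEST FRAMING. Venture `Summits/Ventures/Crystal3D` (cell `crystal3d-full`), route `route-Ventures-StickyWulffConstant`, helper `--supports` the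
law-v5 crux `TextureLiminfV5` (stmt-Ventures-23912).  Elementary measure geometry for the curtain count (standard axioms; no mesh constructed).

* `wcross` — the cross product in `E3` with `inner_wcross_left/right`, `norm_wcross` (a unit vector orthogonal to two orthogonal unit vectors);
* `exists_onb_triple`, `parseval_triple` — an orthonormal triple is an orthonormal basis; `‖w‖² = ⟪d,w⟫² + ⟪e,w⟫² + ⟪n,w⟫²`;
* **`facetArea_le_rect`** — a planar set inside the rectangle `{⟪d,·⟫ = κ, |⟪e,·⟫ − γ| ≤ α, β₁ ≤ ⟪n,·⟫ ≤ β₂}` has `facetArea ≤ 2α·(β₂ − β₁)`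
  (its unit prism lies in a box; isometry-invariance of volume + '…RungPerBox' `volume_coordBox`-style computation);
* `wallRect`, **`facetArea_wallRect_le`** — the wall rectangle of a vacant in-plane pair `(b, v)` (`‖v − b‖ = 1`, `v − b ⊥ n₀`): the points of the
  bisector plane within the closed hexagon reach (`1/(2√3)` along the wall) and within `hB` of `b`'s layer; its area is at most `4·(√3/6)·hB = (2/3)√2`;
* `Mesh₅.closure_hexPrism_inter_plane_subset_wallRect` — the closed prism of a riser site `c` meets the wall plane towards `c + d` inside that rectangle
  (for any unit normal `n₀ = ± rn r`).
-/

noncomputable section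

open scoped BigOperators InnerProductSpace
open MeasureTheory

namespace Summit.Ventures.Crystal3D.Cruxes.TextureLiminf.TexShadow

open Summit.Ventures.Crystal3D Summit.Ventures.Crystal3D.Theorems Set
open Summit.Ventures.Crystal3D.TentCertificate (hB hB_sq hB_pos)
open Literature.Algebra.EuclideanLattices (inner_fin_three norm_sq_fin_three)

/-! ### The cross product -/

/-- the cross product of `E3` -/
def wcross (a b : E3) : E3 := !₂[a 1 * b 2 - a 2 * b 1, a 2 * b 0 - a 0 * b 2, a 0 * b 1 - a 1 * b 0]

/-- coordinates of the cross product -/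
private theorem wcross_apply (a b : E3) :
    wcross a b 0 = a 1 * b 2 - a 2 * b 1 ∧ wcross a b 1 = a 2 * b 0 - a 0 * b 2 ∧ wcross a b 2 = a 0 * b 1 - a 1 * b 0 := by
  refine ⟨?_, ?_, ?_⟩ <;> simp [wcross]

/-- `a × b ⊥ a`. -/
theorem inner_wcross_left (a b : E3) : ⟪wcross a b, a⟫_ℝ = 0 := by
  obtain ⟨h0, h1, h2⟩ := wcross_apply a b
  rw [inner_fin_three, h0, h1, h2]; ring

/-- `a × b ⊥ b`. -/
theorem inner_wcross_right (a b : E3) : ⟪wcross a b, b⟫_ℝ = 0 := by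
  obtain ⟨h0, h1, h2⟩ := wcross_apply a b
  rw [inner_fin_three, h0, h1, h2]; ring

/-- Lagrange: `‖a × b‖² = ‖a‖²‖b‖² − ⟪a,b⟫²`. -/
theorem norm_wcross_sq (a b : E3) : ‖wcross a b‖ ^ 2 = ‖a‖ ^ 2 * ‖b‖ ^ 2 - ⟪a, b⟫_ℝ ^ 2 := by
  obtain ⟨h0, h1, h2⟩ := wcross_apply a b
  rw [norm_sq_fin_three, norm_sq_fin_three, norm_sq_fin_three, inner_fin_three, h0, h1, h2]; ring

/-- The cross product of two orthogonal unit vectors is a unit vector. -/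
theorem norm_wcross {a b : E3} (ha : ‖a‖ = 1) (hb : ‖b‖ = 1) (hab : ⟪a, b⟫_ℝ = 0) : ‖wcross a b‖ = 1 := by
  have h := norm_wcross_sq a b
  rw [ha, hb, hab] at h
  have h1 : ‖wcross a b‖ ^ 2 = 1 := by rw [h]; ring
  nlinarith [norm_nonneg (wcross a b)]

/-! ### Orthonormal triples -/

section Triple

variable {d e n : E3} (hd : ‖d‖ = 1) (he : ‖e‖ = 1) (hn : ‖n‖ = 1) (hde : ⟪d, e⟫_ℝ = 0) (hdn : ⟪d, n⟫_ℝ = 0) (hen : ⟪e, n⟫_ℝ = 0)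
include hd he hn hde hdn hen

/-- An orthonormal triple is orthonormal. -/
theorem orthonormal_triple : Orthonormal ℝ ![d, e, n] := by
  have hed : ⟪e, d⟫_ℝ = 0 := by rw [real_inner_comm]; exact hde
  have hnd : ⟪n, d⟫_ℝ = 0 := by rw [real_inner_comm]; exact hdn
  have hne : ⟪n, e⟫_ℝ = 0 := by rw [real_inner_comm]; exact hen
  rw [orthonormal_iff_ite]
  intro i j
  fin_cases i <;> fin_cases j <;> simp [hd, he, hn, hde, hed, hdn, hnd, hen, hne]

/-- **An orthonormal triple is an orthonormal basis of `E3`.** -/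
theorem exists_onb_triple : ∃ O : OrthonormalBasis (Fin 3) ℝ E3, (⇑O : Fin 3 → E3) = ![d, e, n] := by
  have hon := orthonormal_triple hd he hn hde hdn hen
  have hcard : Fintype.card (Fin 3) = Module.finrank ℝ E3 := by simp
  refine ⟨(basisOfOrthonormalOfCardEqFinrank hon hcard).toOrthonormalBasis ?_, ?_⟩
  · rw [coe_basisOfOrthonormalOfCardEqFinrank]; exact hon
  · rw [Module.Basis.coe_toOrthonormalBasis, coe_basisOfOrthonormalOfCardEqFinrank]

/-- **Parseval for an orthonormal triple.** -/
theorem parseval_triple (w : E3) : ‖w‖ ^ 2 = ⟪d, w⟫_ℝ ^ 2 + ⟪e, w⟫_ℝ ^ 2 + ⟪n, w⟫_ℝ ^ 2 := by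
  obtain ⟨O, hO⟩ := exists_onb_triple hd he hn hde hdn hen
  have h := O.sum_inner_mul_inner w w
  rw [Fin.sum_univ_three, real_inner_self_eq_norm_sq] at h
  have h0 : O 0 = d := by rw [hO]; rfl
  have h1 : O 1 = e := by rw [hO]; rfl
  have h2 : O 2 = n := by rw [hO]; rfl
  rw [h0, h1, h2, real_inner_comm d w, real_inner_comm e w, real_inner_comm n w] at h
  rw [sq, sq, sq]; linarith

/-- **Area of a planar set inside a rectangle**: `F ⊆ {⟪d,·⟫ = κ} ∩ {|⟪e,·⟫ − γ| ≤ α} ∩ {β₁ ≤ ⟪n,·⟫ ≤ β₂}` has `facetArea F d ≤ 2α·(β₂ − β₁)`. -/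
theorem facetArea_le_rect {κ γ α β₁ β₂ : ℝ} (hα : 0 ≤ α) (hβ : β₁ ≤ β₂) {F : Set E3}
    (hF : F ⊆ {x : E3 | ⟪d, x⟫_ℝ = κ ∧ |⟪e, x⟫_ℝ - γ| ≤ α ∧ β₁ ≤ ⟪n, x⟫_ℝ ∧ ⟪n, x⟫_ℝ ≤ β₂}) :
    facetArea F d ≤ 2 * α * (β₂ - β₁) := by
  obtain ⟨O, hO⟩ := exists_onb_triple hd he hn hde hdn hen
  have h0 : O 0 = d := by rw [hO]; rfl
  have h1 : O 1 = e := by rw [hO]; rfl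
  have h2 : O 2 = n := by rw [hO]; rfl
  have hrep : ∀ (x : E3) (i : Fin 3), O.repr x i = ⟪O i, x⟫_ℝ := fun x i => O.repr_apply_apply x i
  -- the box in coordinates and its volume
  set lo : Fin 3 → ℝ := ![κ, γ - α, β₁] with hlo
  set hi : Fin 3 → ℝ := ![κ + 1, γ + α, β₂] with hhi
  set C : Set (EuclideanSpace ℝ (Fin 3)) := (WithLp.ofLp : EuclideanSpace ℝ (Fin 3) → (Fin 3 → ℝ)) ⁻¹' Set.Icc lo hi with hC
  have hCm : MeasurableSet C := measurableSet_Icc.preimage (PiLp.volume_preserving_ofLp (Fin 3)).measurable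
  have hvolC : volume C = ENNReal.ofReal (2 * α * (β₂ - β₁)) := by
    rw [hC, (PiLp.volume_preserving_ofLp (Fin 3)).measure_preimage measurableSet_Icc.nullMeasurableSet, Real.volume_Icc_pi,
      Fin.prod_univ_three]
    have e0 : hi 0 - lo 0 = 1 := by simp [hhi, hlo]
    have e1 : hi 1 - lo 1 = 2 * α := by simp [hhi, hlo]; ring
    have e2 : hi 2 - lo 2 = β₂ - β₁ := by simp [hhi, hlo]
    rw [e0, e1, e2, ← ENNReal.ofReal_mul (by norm_num), ← ENNReal.ofReal_mul (by nlinarith), one_mul]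
  -- the prism over `F` lies in the pulled-back box
  set Bx : Set E3 := O.repr ⁻¹' C with hBx
  have hvolBx : volume Bx = volume C := (O.repr.measurePreserving).measure_preimage hCm.nullMeasurableSet
  have hsub : {x : E3 | ∃ y ∈ F, ∃ t ∈ Set.Icc (0 : ℝ) 1, x = y + t • d} ⊆ Bx := by
    rintro _ ⟨y, hy, t, ht, rfl⟩
    obtain ⟨hyd, hye, hyn1, hyn2⟩ := hF hy
    rw [abs_le] at hye
    have hdd : ⟪d, d⟫_ℝ = 1 := by rw [real_inner_self_eq_norm_sq, hd, one_pow]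
    have hed : ⟪e, d⟫_ℝ = 0 := by rw [real_inner_comm]; exact hde
    have hnd : ⟪n, d⟫_ℝ = 0 := by rw [real_inner_comm]; exact hdn
    have c0 : O.repr (y + t • d) 0 = κ + t := by rw [hrep, h0, inner_add_right, real_inner_smul_right, hyd, hdd, mul_one]
    have c1 : O.repr (y + t • d) 1 = ⟪e, y⟫_ℝ := by rw [hrep, h1, inner_add_right, real_inner_smul_right, hed, mul_zero, add_zero]
    have c2 : O.repr (y + t • d) 2 = ⟪n, y⟫_ℝ := by rw [hrep, h2, inner_add_right, real_inner_smul_right, hnd, mul_zero, add_zero]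
    rw [hBx, Set.mem_preimage, hC, Set.mem_preimage, Set.mem_Icc]
    refine ⟨fun k => ?_, fun k => ?_⟩
    · fin_cases k
      · show lo 0 ≤ O.repr (y + t • d) 0; rw [c0]; simp [hlo]; exact ht.1
      · show lo 1 ≤ O.repr (y + t • d) 1; rw [c1]; simp [hlo]; linarith
      · show lo 2 ≤ O.repr (y + t • d) 2; rw [c2]; simp [hlo]; exact hyn1
    · fin_cases k
      · show O.repr (y + t • d) 0 ≤ hi 0; rw [c0]; simp [hhi]; linarith [ht.2]
      · show O.repr (y + t • d) 1 ≤ hi 1; rw [c1]; simp [hhi]; linarith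
      · show O.repr (y + t • d) 2 ≤ hi 2; rw [c2]; simp [hhi]; exact hyn2
  have hne : volume Bx ≠ ⊤ := by rw [hvolBx, hvolC]; exact ENNReal.ofReal_ne_top
  calc facetArea F d = (volume {x : E3 | ∃ y ∈ F, ∃ t ∈ Set.Icc (0 : ℝ) 1, x = y + t • d}).toReal := rfl
    _ ≤ (volume Bx).toReal := ENNReal.toReal_mono hne (measure_mono hsub)
    _ = 2 * α * (β₂ - β₁) := by rw [hvolBx, hvolC, ENNReal.toReal_ofReal (by nlinarith)]

end Triple

/-! ### The wall rectangle of a vacant in-plane pair -/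

/-- the WALL RECTANGLE of the pair `(b, v)` with layer normal `n₀`: points of the bisector plane of `b, v` within `1/(2√3)` along the wall and within
`hB` of `b`'s layer. -/
def wallRect (b v n₀ : E3) : Set E3 :=
  {x : E3 | ⟪v - b, x⟫_ℝ = ⟪v - b, b⟫_ℝ + 1 / 2 ∧ |⟪wcross (v - b) n₀, x⟫_ℝ - ⟪wcross (v - b) n₀, b⟫_ℝ| ≤ Real.sqrt 3 / 6 ∧
    ⟪n₀, b⟫_ℝ - hB ≤ ⟪n₀, x⟫_ℝ ∧ ⟪n₀, x⟫_ℝ ≤ ⟪n₀, b⟫_ℝ + hB}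

/-- `√3·hB = √2`. -/
theorem sqrt_three_mul_hB : Real.sqrt 3 * hB = Real.sqrt 2 := by
  show Real.sqrt 3 * Real.sqrt (2 / 3) = Real.sqrt 2
  rw [← Real.sqrt_mul (by norm_num)]; norm_num

/-- **The wall rectangle has area at most `4·(√3/6)·hB = (2/3)√2`** (and so has every subset of it). -/
theorem facetArea_wallRect_le {b v n₀ : E3} (hd : ‖v - b‖ = 1) (hn : ‖n₀‖ = 1) (hdn : ⟪v - b, n₀⟫_ℝ = 0) {F : Set E3}
    (hF : F ⊆ wallRect b v n₀) : facetArea F (v - b) ≤ 2 * (Real.sqrt 3 / 6) * (2 * hB) := by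
  have he : ‖wcross (v - b) n₀‖ = 1 := norm_wcross hd hn hdn
  have hde : ⟪v - b, wcross (v - b) n₀⟫_ℝ = 0 := by rw [real_inner_comm]; exact inner_wcross_left _ _
  have hen : ⟪wcross (v - b) n₀, n₀⟫_ℝ = 0 := inner_wcross_right _ _
  have h := facetArea_le_rect hd he hn hde hdn hen (κ := ⟪v - b, b⟫_ℝ + 1 / 2) (γ := ⟪wcross (v - b) n₀, b⟫_ℝ)
    (α := Real.sqrt 3 / 6) (β₁ := ⟪n₀, b⟫_ℝ - hB) (β₂ := ⟪n₀, b⟫_ℝ + hB) (by positivity) (by linarith [hB_pos]) (F := F)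
    (fun x hx => hF hx)
  have e : ⟪n₀, b⟫_ℝ + hB - (⟪n₀, b⟫_ℝ - hB) = 2 * hB := by ring
  rw [e] at h
  exact h

/-- The numerical margin: `(26/25)·(4·(√3/6)·hB) ≤ 1` (`= 52√2/75 ≈ 0.9805`). -/
theorem curtain_constant_le_one : (26 / 25 : ℝ) * (2 * (Real.sqrt 3 / 6) * (2 * hB)) ≤ 1 := by
  have h : 2 * (Real.sqrt 3 / 6) * (2 * hB) = 2 / 3 * Real.sqrt 2 := by
    rw [← sqrt_three_mul_hB]; ring
  rw [h]
  have h2 : Real.sqrt 2 ^ 2 = 2 := Real.sq_sqrt (by norm_num)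
  nlinarith [Real.sqrt_nonneg 2]

namespace Mesh₅

variable {C R₀ : ℝ} {N : ℕ} {x : Fin N → E3} {rc : RiseredCover C R₀ N x} {δ : ℝ} (μ : Mesh₅ rc δ)

/-- **The closed prism meets the wall plane towards `c + d` inside the wall rectangle of `(c, c + d)`**, for every unit normal `n₀ = ± rn r`
(`d = rL r (sixDir t)`, `rheight r c = m·hB`). -/
theorem closure_hexPrism_inter_plane_subset_wallRect {r : Fin rc.nr} {c : E3} {m : ℤ} (hc : μ.rheight r c = (m : ℝ) * hB) (t : Fin 6)
    {n₀ : E3} (hn₀ : n₀ = rc.rn r ∨ n₀ = -rc.rn r) :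
    closure (polytope (μ.hexPrism r c m)) ∩ {y : E3 | ⟪(μ.hexWall r c t).1, y⟫_ℝ = (μ.hexWall r c t).2} ⊆
      wallRect c (c + μ.rL r (sixDir t)) n₀ := by
  rintro y ⟨hy, hyp⟩
  obtain ⟨hhex, hlo, hhi⟩ := μ.hexagon_of_mem_closure_hexPrism hy
  have hwin := μ.abs_sub_le_hB_of_window hlo hhi
  rw [← hc, μ.rheight_sub] at hwin
  set d : E3 := μ.rL r (sixDir t) with hd_def
  have hd1 : ‖d‖ = 1 := by rw [hd_def, LinearIsometryEquiv.norm_map, norm_sixDir]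
  have hrn : rc.rn r = μ.rL r e₃ := μ.rn_eq r
  have hdn : ⟪d, rc.rn r⟫_ℝ = 0 := by rw [hd_def, hrn, LinearIsometryEquiv.inner_map_map, inner_sixDir_e₃]
  have hn1 : ‖n₀‖ = 1 := by
    rcases hn₀ with rfl | rfl
    · exact rc.hrn r
    · rw [norm_neg]; exact rc.hrn r
  have hdn₀ : ⟪d, n₀⟫_ℝ = 0 := by
    rcases hn₀ with rfl | rfl
    · exact hdn
    · rw [inner_neg_right, hdn, neg_zero]
  have hsimp : c + d - c = d := add_sub_cancel_left c d
  simp only [wallRect, mem_setOf_eq, hsimp]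
  -- on the wall plane: `⟪d, y − c⟫ = 1/2`
  have hplane : ⟪d, y - c⟫_ℝ = 1 / 2 := by
    simp only [hexWall, mem_setOf_eq] at hyp
    rw [← hd_def] at hyp
    rw [inner_sub_right]; linarith
  -- the height: `|⟪n₀, y − c⟫| ≤ hB`
  have hh : |⟪n₀, y - c⟫_ℝ| ≤ hB := by
    rcases hn₀ with rfl | rfl
    · rw [hrn]; exact hwin
    · rw [inner_neg_left, abs_neg, hrn]; exact hwin
  -- along the wall: Parseval with the triple `(d, d × n₀, n₀)` and the hexagon bound
  set e' : E3 := wcross d n₀ with he'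
  have he1 : ‖e'‖ = 1 := norm_wcross hd1 hn1 hdn₀
  have hde : ⟪d, e'⟫_ℝ = 0 := by rw [real_inner_comm]; exact inner_wcross_left _ _
  have hen : ⟪e', n₀⟫_ℝ = 0 := inner_wcross_right _ _
  have hpars := parseval_triple hd1 he1 hn1 hde hdn₀ hen (y - c)
  have hin := Mesh₅.inplane_sq_le_third_of_hexagon (μ.rL r) (y - c) hhex
  have hn₀sq : ⟪μ.rL r e₃, y - c⟫_ℝ ^ 2 = ⟪n₀, y - c⟫_ℝ ^ 2 := by
    rw [← hrn]
    rcases hn₀ with rfl | rfl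
    · rfl
    · rw [inner_neg_left, neg_sq]
  have hesq : ⟪e', y - c⟫_ℝ ^ 2 ≤ 1 / 12 := by nlinarith [hpars, hin, hn₀sq, hplane]
  have h3 : Real.sqrt 3 ^ 2 = 3 := Real.sq_sqrt (by norm_num)
  have h36 : (Real.sqrt 3 / 6) ^ 2 = 1 / 12 := by rw [div_pow, h3]; norm_num
  have habs : |⟪e', y - c⟫_ℝ| ≤ Real.sqrt 3 / 6 := by
    rw [← Real.sqrt_sq (by positivity : (0 : ℝ) ≤ Real.sqrt 3 / 6), ← Real.sqrt_sq_eq_abs]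
    exact Real.sqrt_le_sqrt (by rw [h36]; exact hesq)
  refine ⟨?_, ?_, ?_, ?_⟩
  · rw [inner_sub_right] at hplane; linarith
  · rw [← inner_sub_right]; exact habs
  · rw [abs_le] at hh; rw [inner_sub_right] at hh; linarith [hh.1]
  · rw [abs_le] at hh; rw [inner_sub_right] at hh; linarith [hh.2]

end Mesh₅

end Summit.Ventures.Crystal3D.Cruxes.TextureLiminf.TexShadow

end
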